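import Literature.MathematicalPhysics.QuantumFieldTheory.TphiSeminormExpectation
import HarnessLib

/-!
# The `T_φ`-seminorm under linear changes of variable; parameters (`T_{φ,y}`) and change of field units

Bauerschmidt–Brydges–Slade measure joint smoothness in the field `φ` and in parameters `y = (V, K)`
by the `T_{φ,y}`-seminorm (BBS 2019, Def. 7.1.1 with `p_𝒴 ≠ 0`). On a product space `E × Y` (sup
norm) the plain `T`-seminorm of `TphiSeminorm.lean` at the point `(φ, y)` already is such a joint
seminorm (its `n`-th term `(𝔥ⁿ/n!)‖Dⁿ F(φ,y)‖` dominates every mixed partial `(𝔥^p𝔥^q/(p!q!))‖∂_φ^p∂_y^q F‖`,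
`p + q = n`), so no separate theory is needed; what is needed, and proved here, is the behaviour of
the seminorm under continuous linear (and affine) maps of the argument:

* `tphiSeminorm_comp_clm_le` — **pull-back by a linear map**: for `L : E' →L E`,
  `‖F ∘ L‖_{T_x(𝔥)} ≤ ‖F‖_{T_{Lx}(𝔥‖L‖)}` (from `Dⁿ(F∘L)(x) = DⁿF(Lx) ∘ (L,…,L)`); with translations,
  `tphiSeminorm_comp_clm_add_le`;
* `tphiSeminorm_comp_smul_le` / `_eq` — **change of field units** (rescaling `φ ↦ cφ` trades `𝔥` for
  `|c|𝔥`), the operation behind the rescaling step of a renormalisation group map;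
* `tphiSeminorm_freeze_right_le`, `tphiSeminorm_freeze_left_le` — **freezing a variable decreases
  the seminorm**: `‖F(·, y)‖_{T_φ(𝔥)} ≤ ‖F‖_{T_{(φ,y)}(𝔥)}` and `‖F(φ, ·)‖_{T_y(𝔥)} ≤ ‖F‖_{T_{(φ,y)}(𝔥)}`
  (BBS: "the `T_φ`-seminorm … is defined on functions `F : 𝒵 → ℝ` with `y` held fixed");
* `norm_fderiv_freeze_le` — **parameter derivatives are controlled by the joint seminorm**:
  `‖∂_y F(φ,y)‖ ≤ 𝔥⁻¹ ‖F‖_{T_{(φ,y)}(𝔥)}` (`N ≥ 1`), the Lipschitz control of an RG map in `(V,K)`.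

## References

* R. Bauerschmidt, D. C. Brydges, G. Slade, *Introduction to a Renormalisation Group Method*,
  LNM 2242 (2019), Def. 7.1.1, §7.1 (the `T_{φ,y}`-seminorm; monotonicity in the norms of the
  spaces). [BauerschmidtBrydgesSlade2019RG]
-/

noncomputable section

namespace Literature.MathematicalPhysics.QuantumFieldTheory

open Finset

variable {E : Type*} [NormedAddCommGroup E] [NormedSpace ℝ E]
variable {E' : Type*} [NormedAddCommGroup E'] [NormedSpace ℝ E']
variable {A : Type*} [NormedRing A] [NormedAlgebra ℝ A]

/-! ### Pull-back by continuous linear maps -/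

/-- Derivatives of a pull-back: `‖Dⁿ(F ∘ L)(x)‖ ≤ ‖DⁿF(Lx)‖ ‖L‖ⁿ`. [folklore] -/
theorem norm_iteratedFDeriv_comp_clm_le {F : E → A} {N : ℕ} (hF : ContDiff ℝ N F) (L : E' →L[ℝ] E)
    (x : E') {n : ℕ} (hn : n ≤ N) :
    ‖iteratedFDeriv ℝ n (F ∘ L) x‖ ≤ ‖iteratedFDeriv ℝ n F (L x)‖ * ‖L‖ ^ n := by
  rw [L.iteratedFDeriv_comp_right hF x (by exact_mod_cast hn)]
  refine (ContinuousMultilinearMap.norm_compContinuousLinearMap_le _ _).trans ?_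
  rw [prod_const, card_univ, Fintype.card_fin]

/-- **Pull-back by a continuous linear map**: `‖F ∘ L‖_{T_x(𝔥)} ≤ ‖F‖_{T_{Lx}(𝔥‖L‖)}` for `𝔥 ≥ 0`
(BBS: the seminorm is monotone decreasing in the norm of the field space).
[cite: BauerschmidtBrydgesSlade2019RG, §7.1] -/
theorem tphiSeminorm_comp_clm_le (N : ℕ) {𝔥 : ℝ} (h𝔥 : 0 ≤ 𝔥) {F : E → A} (hF : ContDiff ℝ N F)
    (L : E' →L[ℝ] E) (x : E') :
    tphiSeminorm N 𝔥 (F ∘ L) x ≤ tphiSeminorm N (𝔥 * ‖L‖) F (L x) := by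
  unfold tphiSeminorm
  refine sum_le_sum fun n hn => ?_
  have hn' : n ≤ N := Nat.lt_succ_iff.1 (mem_range.1 hn)
  have hfac : (0 : ℝ) < n.factorial := by positivity
  calc 𝔥 ^ n / (n.factorial : ℝ) * ‖iteratedFDeriv ℝ n (F ∘ L) x‖
      ≤ 𝔥 ^ n / (n.factorial : ℝ) * (‖iteratedFDeriv ℝ n F (L x)‖ * ‖L‖ ^ n) :=
        mul_le_mul_of_nonneg_left (norm_iteratedFDeriv_comp_clm_le hF L x hn') (by positivity)
    _ = (𝔥 * ‖L‖) ^ n / (n.factorial : ℝ) * ‖iteratedFDeriv ℝ n F (L x)‖ := by rw [mul_pow]; ring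

/-- **Pull-back by a contraction**: if `‖L‖ ≤ 1` then `‖F ∘ L‖_{T_x(𝔥)} ≤ ‖F‖_{T_{Lx}(𝔥)}`.
[cite: BauerschmidtBrydgesSlade2019RG, §7.1] -/
theorem tphiSeminorm_comp_clm_le_of_norm_le_one (N : ℕ) {𝔥 : ℝ} (h𝔥 : 0 ≤ 𝔥) {F : E → A}
    (hF : ContDiff ℝ N F) {L : E' →L[ℝ] E} (hL : ‖L‖ ≤ 1) (x : E') :
    tphiSeminorm N 𝔥 (F ∘ L) x ≤ tphiSeminorm N 𝔥 F (L x) :=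
  (tphiSeminorm_comp_clm_le N h𝔥 hF L x).trans
    (tphiSeminorm_mono_h N (mul_nonneg h𝔥 (norm_nonneg _)) (mul_le_of_le_one_right h𝔥 hL) F (L x))

/-- **Pull-back by an affine map** `x ↦ Lx + a`: `‖F(L· + a)‖_{T_x(𝔥)} ≤ ‖F‖_{T_{Lx+a}(𝔥‖L‖)}`.
[cite: BauerschmidtBrydgesSlade2019RG, §7.1 with Prop. 7.3.1] -/
theorem tphiSeminorm_comp_clm_add_le (N : ℕ) {𝔥 : ℝ} (h𝔥 : 0 ≤ 𝔥) {F : E → A} (hF : ContDiff ℝ N F)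
    (L : E' →L[ℝ] E) (a : E) (x : E') :
    tphiSeminorm N 𝔥 (fun z => F (L z + a)) x ≤ tphiSeminorm N (𝔥 * ‖L‖) F (L x + a) := by
  have hFa : ContDiff ℝ N (fun u => F (u + a)) := hF.comp (contDiff_id.add contDiff_const)
  have h := tphiSeminorm_comp_clm_le N h𝔥 hFa L x
  rw [show ((fun u => F (u + a)) ∘ L) = fun z => F (L z + a) from rfl] at h
  rwa [tphiSeminorm_comp_add_right] at h

/-! ### Change of field units -/

/-- **Rescaling the field**: `‖F(c ·)‖_{T_x(𝔥)} ≤ ‖F‖_{T_{cx}(|c|𝔥)}` — measuring `φ ↦ F(cφ)` in units `𝔥`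
is measuring `F` in units `|c|𝔥`. [cite: BauerschmidtBrydgesSlade2019RG, §7.1 (Lemma 7.1.4)] -/
theorem tphiSeminorm_comp_smul_le (N : ℕ) {𝔥 : ℝ} (h𝔥 : 0 ≤ 𝔥) {F : E → A} (hF : ContDiff ℝ N F)
    (c : ℝ) (x : E) :
    tphiSeminorm N 𝔥 (fun z => F (c • z)) x ≤ tphiSeminorm N (𝔥 * |c|) F (c • x) := by
  have h := tphiSeminorm_comp_clm_le N h𝔥 hF (c • ContinuousLinearMap.id ℝ E) x
  have hL : ‖c • ContinuousLinearMap.id ℝ E‖ ≤ |c| := by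
    rw [norm_smul, Real.norm_eq_abs]
    exact mul_le_of_le_one_right (abs_nonneg c) ContinuousLinearMap.norm_id_le
  calc tphiSeminorm N 𝔥 (fun z => F (c • z)) x
      = tphiSeminorm N 𝔥 (F ∘ (c • ContinuousLinearMap.id ℝ E)) x := rfl
    _ ≤ tphiSeminorm N (𝔥 * ‖c • ContinuousLinearMap.id ℝ E‖) F ((c • ContinuousLinearMap.id ℝ E) x) := h
    _ ≤ tphiSeminorm N (𝔥 * |c|) F (c • x) := by
        refine tphiSeminorm_mono_h N (mul_nonneg h𝔥 (norm_nonneg _)) ?_ F _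
        exact mul_le_mul_of_nonneg_left hL h𝔥

/-! ### Freezing a variable (`T_{φ,y}` restricted to `φ` or to `y`) -/

section Prod

variable {Y : Type*} [NormedAddCommGroup Y] [NormedSpace ℝ Y]

/-- **Freezing the parameter decreases the seminorm**: `‖F(·, y)‖_{T_φ(𝔥)} ≤ ‖F‖_{T_{(φ,y)}(𝔥)}`
(product space with the sup norm). [cite: BauerschmidtBrydgesSlade2019RG, Def. 7.1.1] -/
theorem tphiSeminorm_freeze_right_le (N : ℕ) {𝔥 : ℝ} (h𝔥 : 0 ≤ 𝔥) {F : E × Y → A} (hF : ContDiff ℝ N F)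
    (φ : E) (y : Y) :
    tphiSeminorm N 𝔥 (fun x : E => F (x, y)) φ ≤ tphiSeminorm N 𝔥 F (φ, y) := by
  have h := tphiSeminorm_comp_clm_add_le N h𝔥 hF (ContinuousLinearMap.inl ℝ E Y) ((0 : E), y) φ
  have hL : ‖ContinuousLinearMap.inl ℝ E Y‖ ≤ 1 := ContinuousLinearMap.norm_inl_le_one ℝ E Y
  have hfun : (fun z : E => F (ContinuousLinearMap.inl ℝ E Y z + ((0 : E), y))) = fun x : E => F (x, y) := by
    funext z; simp
  rw [hfun] at h
  refine h.trans ?_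
  have hpt : ContinuousLinearMap.inl ℝ E Y φ + ((0 : E), y) = (φ, y) := by simp
  rw [hpt]
  exact tphiSeminorm_mono_h N (mul_nonneg h𝔥 (norm_nonneg _)) (mul_le_of_le_one_right h𝔥 hL) F _

/-- **Freezing the field decreases the seminorm**: `‖F(φ, ·)‖_{T_y(𝔥)} ≤ ‖F‖_{T_{(φ,y)}(𝔥)}`.
[cite: BauerschmidtBrydgesSlade2019RG, Def. 7.1.1] -/
theorem tphiSeminorm_freeze_left_le (N : ℕ) {𝔥 : ℝ} (h𝔥 : 0 ≤ 𝔥) {F : E × Y → A} (hF : ContDiff ℝ N F)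
    (φ : E) (y : Y) :
    tphiSeminorm N 𝔥 (fun w : Y => F (φ, w)) y ≤ tphiSeminorm N 𝔥 F (φ, y) := by
  have h := tphiSeminorm_comp_clm_add_le N h𝔥 hF (ContinuousLinearMap.inr ℝ E Y) ((φ : E), (0 : Y)) y
  have hL : ‖ContinuousLinearMap.inr ℝ E Y‖ ≤ 1 := ContinuousLinearMap.norm_inr_le_one ℝ E Y
  have hfun : (fun z : Y => F (ContinuousLinearMap.inr ℝ E Y z + ((φ : E), (0 : Y)))) = fun w : Y => F (φ, w) := by
    funext z; simp
  rw [hfun] at h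
  refine h.trans ?_
  have hpt : ContinuousLinearMap.inr ℝ E Y y + ((φ : E), (0 : Y)) = (φ, y) := by simp
  rw [hpt]
  exact tphiSeminorm_mono_h N (mul_nonneg h𝔥 (norm_nonneg _)) (mul_le_of_le_one_right h𝔥 hL) F _

/-- **Parameter derivatives are controlled by the joint seminorm**: for `N ≥ 1` and `𝔥 > 0`,
`‖∂_y F(φ,y)‖ ≤ 𝔥⁻¹ ‖F‖_{T_{(φ,y)}(𝔥)}` — the Lipschitz control of an RG map in its parameters `(V,K)`.
[cite: BauerschmidtBrydgesSlade2019RG, Def. 7.1.1] -/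
theorem norm_fderiv_freeze_le {N : ℕ} (hN : 1 ≤ N) {𝔥 : ℝ} (h𝔥 : 0 < 𝔥) {F : E × Y → A}
    (hF : ContDiff ℝ N F) (φ : E) (y : Y) :
    ‖fderiv ℝ (fun w : Y => F (φ, w)) y‖ ≤ 𝔥⁻¹ * tphiSeminorm N 𝔥 F (φ, y) := by
  have h1 := tphiSeminorm_freeze_left_le N h𝔥.le hF φ y
  -- the order-one term of the seminorm of the frozen function
  have h2 : 𝔥 ^ 1 / ((1 : ℕ).factorial : ℝ) * ‖iteratedFDeriv ℝ 1 (fun w : Y => F (φ, w)) y‖ ≤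
      tphiSeminorm N 𝔥 (fun w : Y => F (φ, w)) y := by
    unfold tphiSeminorm
    exact single_le_sum (f := fun p => 𝔥 ^ p / (p.factorial : ℝ) * ‖iteratedFDeriv ℝ p (fun w : Y => F (φ, w)) y‖)
      (fun p _ => by positivity) (mem_range.2 (Nat.lt_succ_of_le hN))
  rw [pow_one, Nat.factorial_one, Nat.cast_one, div_one, norm_iteratedFDeriv_one] at h2
  rw [inv_mul_eq_div, le_div_iff₀ h𝔥, mul_comm]
  exact h2.trans h1

end Prod

end Literature.MathematicalPhysics.QuantumFieldTheory

end
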